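import Summits.ResolutionOfSingularities.ResolutionOfSingularities.Theorems.FrobeniusClosingPatchingRelPerfectDepthParamLiftChartIndex
import Summits.ResolutionOfSingularities.ResolutionOfSingularities.Theorems.FrobeniusClosingPatchingRelPerfectDepthMultiHostCylCentre
import Literature.AlgebraicGeometry.Resolution.BlowupAlgebraLift
import HarnessLib

/-!
# Crux `PatchingRelPerfect` (stmt-ResolutionOfSingularities-16161), chain W5.2 — F7(β) d = 2 (β-AX), X2a module 2 (M2c), e-chart steps E1b/E1c:
# the two stalk presentations at an e-chart point of the lifted retraction, and the stalk map of `r′` between them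

[OURS · L1 W5.2 · F7(β) (β-AX) X-side · res-D-pv-034 AS res-L1-s36-pv-3 per res-L1-w52-plan-1 RULING G11-21 ((M2c) PARAM
PROPAGATION, e-chart half; blueprint `D/res-D-pv-034/M2C-ECHART-BLUEPRINT.md` steps E1b/E1c).]  Replaces the role of NO printed
item; NOT a statement of the manuscript under review; fact-free, def-free.  AI-written; AI review is weaker than expert review.

At a point `y′ ∈ V′` OVER the pushed centre, with `y := φ y′`, `A := 𝒪_{Z,q y}`, `B := 𝒪_{V,y}`, `B_X := 𝒪_{X,ι y}` (`ε : B_X ≅ B`),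
`σ := q^♯`, generators `a` of the stalk of `C` at `q y` and the common chart index `l` of `…ChartIndex`:
* `CylState.exists_centre_generators` — a local equation `t` of the carrier at `y` with
  `stalkIdeal 𝓘(j V(C)) (ι y) = (ε⁻¹ t, ε⁻¹ σ a_1, …, ε⁻¹ σ a_c)` (CYL-SNC engine + `comap_V_ι_vanishingIdeal_centre`).
* **`CylState.exists_chartPresentation`** — the two stalk presentations (tree `exists_blowupAlgebra_stalk_ringEquiv_of_stalkIdeal_eq_span_at`,
  res-D-pv-029 lineage): `𝒪_{Z′,r′ y′}` is the localisation at a prime over `𝔪_A` of `A[𝔞/a_l]` (`blowupAlgebra`), `𝒪_{X′,ι y′}` the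
  localisation at a prime over `𝔪_{B_X}` of `B_X[𝔟/(ε⁻¹ σ a_l)]`, `𝔟 = (ε⁻¹ t, ε⁻¹ σ a)`; and THE MAP `ψ : A[𝔞/a_l] → B_X[𝔟/ε⁻¹σ a_l]`
  (`blowupAlgebra.lift` of `ε⁻¹ ∘ σ`) with `χ_B ∘ ψ = ε′⁻¹ ∘ r′^♯ ∘ χ_A` (`blowupAlgebra.ringHom_ext`: both extend
  `x ↦ τ^♯ ε⁻¹ σ x` by the two stalk squares, and the image of `a_l` generates the exceptional stalk, a regular element).

## References
* U. Görtz, T. Wedhorn, *Algebraic Geometry I* (2020), (13.19) p. 415 (affine blowup algebra, universal property). [GortzWedhorn2020]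
* The Stacks Project, Tag 0804. [StacksProject]
-/

-- `Summit.<Summit>.<Sub>.Theorems` with `Sub = Summit` (single-conjunct summit, D-0017)
set_option linter.dupNamespace false

noncomputable section

open CategoryTheory AlgebraicGeometry TopologicalSpace IsLocalRing
open Literature.AlgebraicGeometry.Resolution
open Scheme.IdealSheafData

namespace Summit.ResolutionOfSingularities.ResolutionOfSingularities.Theorems.DepthMultiHost

universe u

namespace CylState

variable {X : Scheme.{u}} {S : MultiHostState X} (cyl : CylState S)

/-! ## §1 Generators of the pushed centre at a point of the cylinder region over it -/

/-- **Generators of `𝓘(j V(C))` at `ι y`, `y` a carrier point of the cylinder region**: a local equation `t` of the carrier with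
`(𝓘_Z|_V)_y = (t)` and `𝓘(j V(C))_{ι y} = (ε⁻¹ t, ε⁻¹ σ a_1, …, ε⁻¹ σ a_c)` for any generators `a` of `C_{q y}` (`C` having simple
normal crossings with some family, e.g. the boundary traces). [cite: Kollar2007, (3.111) Step 1] -/
theorem exists_centre_generators (C : cyl.Z.IdealSheafData) (𝓕 : List cyl.Z.IdealSheafData) (h𝓕 : HasSNCWith 𝓕 C)
    (y : (cyl.V : Scheme.{u})) (hy : y ∈ (cyl.j.ker.comap cyl.V.ι).support)
    {c : ℕ} (a : Fin c → cyl.Z.presheaf.stalk (cyl.q y)) (ha : Ideal.span (Set.range a) = stalkIdeal C (cyl.q y)) :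
    ∃ t : (cyl.V : Scheme.{u}).presheaf.stalk y,
      stalkIdeal (cyl.j.ker.comap cyl.V.ι) y = Ideal.span {t} ∧
      stalkIdeal (vanishingIdeal (cyl.centre C)) (cyl.V.ι y) =
        Ideal.span (Set.range fun m => (asIso (cyl.V.ι.stalkMap y)).commRingCatIsoToRingEquiv.symm
          ((Fin.cons t (fun i => (cyl.q.stalkMap y).hom (a i)) : Fin (c + 1) → (cyl.V : Scheme.{u}).presheaf.stalk y) m)) := by
  classical
  obtain ⟨m, z, -, ⟨lab, -, hlabD⟩, -, -⟩ := cyl.exists_isRsopPart_labels_cylinder 𝓕 C h𝓕 y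
  set t := z (lab ⟨cyl.j.ker.comap cyl.V.ι, List.mem_cons_self, hy⟩) with htdef
  have ht : stalkIdeal (cyl.j.ker.comap cyl.V.ι) y = Ideal.span {t} := hlabD ⟨_, List.mem_cons_self, hy⟩
  refine ⟨t, ht, ?_⟩
  set ε : X.presheaf.stalk (cyl.V.ι y) ≃+* (cyl.V : Scheme.{u}).presheaf.stalk y :=
    (asIso (cyl.V.ι.stalkMap y)).commRingCatIsoToRingEquiv with hε
  -- `𝓘(W)|_V = 𝓘_Z|_V ⊔ q^* C`, read at `y`, pulled back along `ε`
  have hW := cyl.comap_V_ι_vanishingIdeal_centre C 𝓕 h𝓕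
  have h1 : stalkIdeal ((vanishingIdeal (cyl.centre C)).comap cyl.V.ι) y =
      Ideal.span (Set.range (Fin.cons t (fun i => (cyl.q.stalkMap y).hom (a i)) : Fin (c + 1) → _)) := by
    rw [hW, stalkIdeal_sup, ht, stalkIdeal_comap_eq_map_stalkMap, ← ha, Ideal.map_span, Fin.range_cons, Ideal.span_insert,
      ← Set.range_comp]
    rfl
  have h2 : stalkIdeal (vanishingIdeal (cyl.centre C)) (cyl.V.ι y) =
      (stalkIdeal ((vanishingIdeal (cyl.centre C)).comap cyl.V.ι) y).map (ε.symm : _ →+* _) := by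
    rw [stalkIdeal_comap_eq_map_stalkMap, Ideal.map_map]
    have : (ε.symm : _ →+* _).comp (cyl.V.ι.stalkMap y).hom = RingHom.id _ := by
      ext b; exact ε.symm_apply_apply b
    rw [this, Ideal.map_id]
  rw [h2, h1, Ideal.map_span, ← Set.range_comp]
  rfl

/-! ## §2 The map between the two affine blowup algebras (ring level) -/

end CylState

section Algebra

variable {A Bx RX : Type u} [CommRing A] [CommRing Bx]

/-- **The chart map `ψ : A[𝔞/a_l] → B[𝔟/c_{l+1}]`** for a ring map `σx : A → B` with `σx (a i) = c i.succ`: the lift of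
`A → B → B[𝔟/c_{l+1}]` (`blowupAlgebra.lift`; the image of `a_l` is `c_{l+1}`, a regular element generating `𝔟 · B[𝔟/c_{l+1}]`).
[cite: GortzWedhorn2020, (13.19) p. 415] -/
theorem exists_blowupAlgebra_chartMap {c : ℕ} (a : Fin c → A) (cX : Fin (c + 1) → Bx) (σx : A →+* Bx)
    (hσ : ∀ i, σx (a i) = cX i.succ) (l : Fin c) :
    ∃ ψ : blowupAlgebra (Ideal.span (Set.range a)) (a l) →+* blowupAlgebra (Ideal.span (Set.range cX)) (cX l.succ),
      ∀ x, ψ (algebraMap _ _ x) = algebraMap _ _ (σx x) := by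
  set φ₀ : A →+* blowupAlgebra (Ideal.span (Set.range cX)) (cX l.succ) :=
    (algebraMap _ (blowupAlgebra (Ideal.span (Set.range cX)) (cX l.succ))).comp σx with hφ₀
  have hφ₀a : ∀ i, φ₀ (a i) = algebraMap _ _ (cX (Fin.succ i)) := fun i => by
    simp only [hφ₀, RingHom.comp_apply, hσ]
  have haψ : φ₀ (a l) ∈ nonZeroDivisors _ := by
    rw [hφ₀a]; exact algebraMap_mem_nonZeroDivisors_blowupAlgebra
  have hmem : cX l.succ ∈ Ideal.span (Set.range cX) := Ideal.subset_span (Set.mem_range_self _)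
  have hIψ : (Ideal.span (Set.range a)).map φ₀ ≤ Ideal.span {φ₀ (a l)} := by
    rw [Ideal.map_span, Ideal.span_le, hφ₀a]
    rintro _ ⟨_, ⟨i, rfl⟩, rfl⟩
    rw [hφ₀a, SetLike.mem_coe, ← map_blowupAlgebra_eq_span hmem]
    exact Ideal.mem_map_of_mem _ (Ideal.subset_span (Set.mem_range_self _))
  exact ⟨blowupAlgebra.lift (Ideal.span (Set.range a)) haψ hIψ, fun x => by
    rw [blowupAlgebra.lift_algebraMap]; rfl⟩

/-- **Compatibility by the universal property**: two ring maps out of `A[𝔞/a_l]` agreeing on `A` with a map whose value at `a_l` is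
regular in the target coincide (`blowupAlgebra.ringHom_ext`), in the shape «`χ_B ∘ ψ = ε ∘ r ∘ χ_A`». [cite: GortzWedhorn2020, (13.19) p. 415] -/
theorem blowupAlgebra_chartMap_comp_eq {c : ℕ} (a : Fin c → A) (l : Fin c) {T SA : Type u} [CommRing T] [CommRing SA] [CommRing RX]
    (ψ : blowupAlgebra (Ideal.span (Set.range a)) (a l) →+* RX) (χB : RX →+* T)
    (χA : blowupAlgebra (Ideal.span (Set.range a)) (a l) →+* SA) (g : SA →+* T) (Φ : A →+* T)
    (hB : ∀ x, χB (ψ (algebraMap _ _ x)) = Φ x) (hA : ∀ x, g (χA (algebraMap _ _ x)) = Φ x)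
    (hreg : Φ (a l) ∈ nonZeroDivisors T) : χB.comp ψ = g.comp χA := by
  refine blowupAlgebra.ringHom_ext (Ideal.span (Set.range a)) (φ := Φ) hreg ?_ ?_
  · ext x; exact hB x
  · ext x; exact hA x

end Algebra

/-! ## §3 The two presentations and the map -/

namespace CylState

variable {X : Scheme.{u}} {S : MultiHostState X} (cyl : CylState S)



section Presentation

variable {X' Z' : Scheme.{u}} (C : cyl.Z.IdealSheafData) {τ : X' ⟶ X} (hτ : IsBlowup τ (vanishingIdeal (cyl.centre C)))
  {τZ : Z' ⟶ cyl.Z} (hτZ : IsBlowup τZ C) {V' : X'.Opens} (r' : (V' : Scheme.{u}) ⟶ Z')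
  (φ : (V' : Scheme.{u}) ⟶ (cyl.V : Scheme.{u})) (hφ : φ ≫ cyl.V.ι = V'.ι ≫ τ) (hr'τ : r' ≫ τZ = φ ≫ cyl.q)
  (hexc : (C.comap τZ).comap r' = ((vanishingIdeal (cyl.centre C)).comap τ).comap V'.ι) (y' : (V' : Scheme.{u}))

include hτ hτZ hφ hr'τ hexc in
set_option maxHeartbeats 800000 in -- two `blowupAlgebra` chart presentations (subalgebras of localisations): slow instance unification (cf. p537631, which needs 400000 for ONE)
/-- [OURS · L1 W5.2 · F7(β) (β-AX) M2c, E1b/E1c] **The two stalk presentations at an e-chart point and the map between them.**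
See the module docstring. [cite: GortzWedhorn2020, (13.19) p. 415] [cite: StacksProject, Tag 0804] -/
theorem exists_chartPresentation (𝓕 : List cyl.Z.IdealSheafData) (h𝓕 : HasSNCWith 𝓕 C)
    (hy : τ (V'.ι y') ∈ (cyl.centre C : Set X))
    {c : ℕ} (a : Fin c → cyl.Z.presheaf.stalk (cyl.q (φ y'))) (ha : Ideal.span (Set.range a) = stalkIdeal C (cyl.q (φ y'))) :
    ∃ (l : Fin c) (t : (cyl.V : Scheme.{u}).presheaf.stalk (φ y'))
      (cX : Fin (c + 1) → X.presheaf.stalk (cyl.V.ι (φ y')))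
      (𝔔A : PrimeSpectrum (blowupAlgebra (Ideal.span (Set.range a)) (a l)))
      (χA : blowupAlgebra (Ideal.span (Set.range a)) (a l) →+* Z'.presheaf.stalk (r' y'))
      (𝔔B : PrimeSpectrum (blowupAlgebra (Ideal.span (Set.range cX)) (cX l.succ)))
      (χB : blowupAlgebra (Ideal.span (Set.range cX)) (cX l.succ) →+* X'.presheaf.stalk (V'.ι y'))
      (ψ : blowupAlgebra (Ideal.span (Set.range a)) (a l) →+* blowupAlgebra (Ideal.span (Set.range cX)) (cX l.succ)),
      stalkIdeal (cyl.j.ker.comap cyl.V.ι) (φ y') = Ideal.span {t} ∧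
      (cX = fun m => (asIso (cyl.V.ι.stalkMap (φ y'))).commRingCatIsoToRingEquiv.symm
          ((Fin.cons t (fun i => (cyl.q.stalkMap (φ y')).hom (a i)) :
            Fin (c + 1) → (cyl.V : Scheme.{u}).presheaf.stalk (φ y')) m)) ∧
      Ideal.span (Set.range cX) = stalkIdeal (vanishingIdeal (cyl.centre C)) (cyl.V.ι (φ y')) ∧
      (∀ x, χA (algebraMap _ _ x) =
        ((cyl.Z.presheaf.stalkCongr (.of_eq (cyl.τZ_r_eq r' φ hr'τ y'))).inv ≫ τZ.stalkMap (r' y')).hom x) ∧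
      @IsLocalization.AtPrime _ _ (Z'.presheaf.stalk (r' y')) _ χA.toAlgebra 𝔔A.asIdeal _ ∧
      𝔔A.asIdeal.comap (algebraMap _ (blowupAlgebra (Ideal.span (Set.range a)) (a l))) =
        maximalIdeal (cyl.Z.presheaf.stalk (cyl.q (φ y'))) ∧
      (∀ b, χB (algebraMap _ _ b) =
        ((X.presheaf.stalkCongr (.of_eq (cyl.τ_ι_eq φ hφ y'))).inv ≫ τ.stalkMap (V'.ι y')).hom b) ∧
      @IsLocalization.AtPrime _ _ (X'.presheaf.stalk (V'.ι y')) _ χB.toAlgebra 𝔔B.asIdeal _ ∧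
      𝔔B.asIdeal.comap (algebraMap _ (blowupAlgebra (Ideal.span (Set.range cX)) (cX l.succ))) =
        maximalIdeal (X.presheaf.stalk (cyl.V.ι (φ y'))) ∧
      (∀ x, ψ (algebraMap _ _ x) =
        algebraMap _ _ ((asIso (cyl.V.ι.stalkMap (φ y'))).commRingCatIsoToRingEquiv.symm ((cyl.q.stalkMap (φ y')).hom x))) ∧
      χB.comp ψ = ((asIso (V'.ι.stalkMap y')).commRingCatIsoToRingEquiv.symm.toRingHom.comp (r'.stalkMap y').hom).comp χA := by
  classical
  -- notation
  set ε : X.presheaf.stalk (cyl.V.ι (φ y')) ≃+* (cyl.V : Scheme.{u}).presheaf.stalk (φ y') :=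
    (asIso (cyl.V.ι.stalkMap (φ y'))).commRingCatIsoToRingEquiv with hε
  set ε' : X'.presheaf.stalk (V'.ι y') ≃+* (V' : Scheme.{u}).presheaf.stalk y' :=
    (asIso (V'.ι.stalkMap y')).commRingCatIsoToRingEquiv with hε'
  set σ : cyl.Z.presheaf.stalk (cyl.q (φ y')) →+* (cyl.V : Scheme.{u}).presheaf.stalk (φ y') :=
    (cyl.q.stalkMap (φ y')).hom with hσ
  set ρ : cyl.Z.presheaf.stalk (cyl.q (φ y')) →+* Z'.presheaf.stalk (r' y') :=
    ((cyl.Z.presheaf.stalkCongr (.of_eq (cyl.τZ_r_eq r' φ hr'τ y'))).inv ≫ τZ.stalkMap (r' y')).hom with hρ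
  set θ : X.presheaf.stalk (cyl.V.ι (φ y')) →+* X'.presheaf.stalk (V'.ι y') :=
    ((X.presheaf.stalkCongr (.of_eq (cyl.τ_ι_eq φ hφ y'))).inv ≫ τ.stalkMap (V'.ι y')).hom with hθ
  set rr : Z'.presheaf.stalk (r' y') →+* (V' : Scheme.{u}).presheaf.stalk y' := (r'.stalkMap y').hom with hrr
  -- the carrier point `φ y′` and the generators of the pushed centre there
  have hyV : φ y' ∈ (cyl.j.ker.comap cyl.V.ι).support := by
    haveI := cyl.closedImmersion
    rw [support_comap]
    show cyl.V.ι (φ y') ∈ (cyl.j.ker.support : Set X)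
    rw [Scheme.Hom.support_ker, cyl.j.isClosedEmbedding.isClosed_range.closure_eq, ← cyl.τ_ι_eq φ hφ y']
    exact cyl.centre_subset_range C hy
  obtain ⟨t, ht, hgen⟩ := cyl.exists_centre_generators C 𝓕 h𝓕 (φ y') hyV a ha
  set cX : Fin (c + 1) → X.presheaf.stalk (cyl.V.ι (φ y')) :=
    fun m => ε.symm ((Fin.cons t (fun i => σ (a i)) : Fin (c + 1) → (cyl.V : Scheme.{u}).presheaf.stalk (φ y')) m) with hcX
  have hcXsucc : ∀ i, cX (Fin.succ i) = ε.symm (σ (a i)) := fun i => by simp [hcX]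
  have hcXspan : Ideal.span (Set.range cX) = stalkIdeal (vanishingIdeal (cyl.centre C)) (cyl.V.ι (φ y')) := hgen.symm
  -- the chart index
  obtain ⟨l, hl1, hl2⟩ := cyl.exists_chartIndex C hτ hτZ r' φ hφ hr'τ hexc y' a ha
  have hl1' : stalkIdeal ((vanishingIdeal (cyl.centre C)).comap τ) (V'.ι y') = Ideal.span {θ (cX l.succ)} := by
    rw [hl1, hcXsucc]
  -- the two presentations
  obtain ⟨𝔔A, χA, -, hχA, hlocA, -, h𝔔A⟩ :=
    Cruxes.EquisingularLiftNat.Sections.exists_blowupAlgebra_stalk_ringEquiv_of_stalkIdeal_eq_span_at hτZ (r' y')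
      (cyl.q (φ y')) (cyl.τZ_r_eq r' φ hr'τ y') a ha l hl2
  obtain ⟨𝔔B, χB, -, hχB, hlocB, -, h𝔔B⟩ :=
    Cruxes.EquisingularLiftNat.Sections.exists_blowupAlgebra_stalk_ringEquiv_of_stalkIdeal_eq_span_at hτ (V'.ι y')
      (cyl.V.ι (φ y')) (cyl.τ_ι_eq φ hφ y') cX hcXspan l.succ hl1'
  -- the map `ψ = lift of ε⁻¹ ∘ σ`
  obtain ⟨ψ, hψalg⟩ := exists_blowupAlgebra_chartMap a cX (ε.symm.toRingHom.comp σ) (fun i => (hcXsucc i).symm) l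
  -- compatibility `χ_B ∘ ψ = ε′⁻¹ ∘ r′^♯ ∘ χ_A`: both extend `x ↦ θ (ε⁻¹ σ x)`, the image of `a l` being regular
  have hsq : ∀ x, ε'.symm (rr (ρ x)) = θ (ε.symm (σ x)) := fun x => by
    have h1 : rr (ρ x) = (φ.stalkMap y').hom (σ x) := cyl.stalkMap_square_r r' φ hr'τ y' x
    have h2 := cyl.stalkMap_square_φ φ hφ y' (ε.symm (σ x))
    have h3 : (cyl.V.ι.stalkMap (φ y')).hom (ε.symm (σ x)) = σ x := ε.apply_symm_apply (σ x)
    rw [h3] at h2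
    rw [h1, h2]
    exact ε'.symm_apply_apply _
  have hreg : θ (ε.symm (σ (a l))) ∈ nonZeroDivisors (X'.presheaf.stalk (V'.ι y')) := by
    obtain ⟨g, hg, hIg⟩ := hτ.isEffectiveCartier.exists_stalkIdeal_eq_span (V'.ι y')
    have h1 : Ideal.span {θ (cX l.succ)} = Ideal.span {g} := hl1'.symm.trans hIg
    rw [hcXsucc] at h1
    exact mem_nonZeroDivisors_of_span_singleton_eq h1 hg
  have hcomp : χB.comp ψ = (ε'.symm.toRingHom.comp rr).comp χA :=
    blowupAlgebra_chartMap_comp_eq a l ψ χB χA (ε'.symm.toRingHom.comp rr) (θ.comp (ε.symm.toRingHom.comp σ))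
      (fun x => by rw [hψalg, hχB]; rfl) (fun x => by
        show ε'.symm (rr (χA (algebraMap _ _ x))) = θ (ε.symm (σ x))
        rw [hχA, ← hsq]) hreg
  exact ⟨l, t, cX, 𝔔A, χA, 𝔔B, χB, ψ, ht, rfl, hcXspan, hχA, hlocA, h𝔔A, hχB, hlocB, h𝔔B,
    fun x => hψalg x, hcomp⟩

end Presentation

end CylState

end Summit.ResolutionOfSingularities.ResolutionOfSingularities.Theorems.DepthMultiHost

end
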